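import Literature.Probability.LatticeModels.MeshDomainJordan
import Literature.Probability.Percolation.BoxCrossingProofs
import HarnessLib

/-!
# Walk transfer from the mesh graph of a Jordan sub-domain to `Ω_δ(D)`
— UBHP brick of line `symplectic-fermion-anchor`
(crux `SAWLoopFugacityFlow.AvoidanceLimit`, stmt-CriticalPhenomena-10649; sub-goal
"(T) lattice uniform local connectivity of Jordan domains")

For Jordan domains `N ⊆ D` (only `N.carrier ⊆ D.carrier` is used) and a mesh `δ`, a path of the mesh
graph of `N` on its mesh vertices (`meshVertexGraph N.carrier δ`: vertices with mesh point in
`N.carrier`, edges the `ℤ²`-edges whose closed rescaled segment lies in `closure N.carrier`) that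
starts at a vertex of the discrete domain `Ω_δ(D) = meshDomain D.carrier δ` (the largest mesh
component(s) of `D`) is a walk of the graph `discreteDomainGraph D.carrier δ`, all of whose vertices
have mesh point in `N.carrier` and lie in `meshDomain D.carrier δ`
(`exists_discreteDomainGraph_walk_of_reachable`, registered signature).

Proof: each edge is a `meshGraph D.carrier δ` edge (`closure N.carrier ⊆ closure D.carrier`), and
membership in `meshDomain D.carrier δ` propagates along `meshGraph D.carrier δ` edges between mesh
vertices of `D` (`Literature.Probability.Percolation.mem_meshDomain_of_meshGraph_adj` of
`BoxCrossingProofs.lean`: `meshDomain` is a union of whole connected components of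
`meshVertexGraph`); induct along a walk witnessing reachability.

Sources: folklore (definitions of `DomainDiscretisation.lean`, the component-closure lemma of
`BoxCrossingProofs.lean`, and Mathlib's `SimpleGraph.Walk` API only). No definitions.
-/

noncomputable section

open scoped Topology
open Literature.Probability.RandomPlanarGeometry Literature.Probability.LatticeModels

namespace Summit.CriticalPhenomena.SAWScalingLimit.Theorems.AvoidanceLimit.Anchor

/-- **Walk transfer from a sub-domain's mesh graph to `Ω_δ(D)`.** For Jordan domains with
`N.carrier ⊆ D.carrier`, a mesh `δ > 0`, and mesh vertices `x y` of `N` joined in the mesh graph of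
`N` on its mesh vertices, if `x ∈ meshDomain D.carrier δ` then there is a walk from `x` to `y` in
`discreteDomainGraph D.carrier δ` all of whose vertices have mesh point in `N.carrier` and belong to
`meshDomain D.carrier δ`. (Each mesh edge of `N` is a mesh edge of `D`, the closed segment lying in
`closure N.carrier ⊆ closure D.carrier`, and `meshDomain D.carrier δ` is closed under such edges,
`Literature.Probability.Percolation.mem_meshDomain_of_meshGraph_adj`; induction along a walk.)
[folklore] -/
theorem exists_discreteDomainGraph_walk_of_reachable :
    ∀ (D N : JordanDomain) (δ : ℝ), 0 < δ → N.carrier ⊆ D.carrier →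
      ∀ (x y : ↥(meshVertices N.carrier δ)), (meshVertexGraph N.carrier δ).Reachable x y →
        (x : Site 2) ∈ meshDomain D.carrier δ →
        ∃ w : (discreteDomainGraph D.carrier δ).Walk (x : Site 2) (y : Site 2),
          ∀ z ∈ w.support, meshPoint δ z ∈ N.carrier ∧ z ∈ meshDomain D.carrier δ := by
  intro D N δ _ hND x y hxy hxD
  obtain ⟨p⟩ := hxy
  induction p with
  | @nil u =>
    refine ⟨SimpleGraph.Walk.nil, fun z hz => ?_⟩
    rw [SimpleGraph.Walk.support_nil, List.mem_singleton] at hz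
    subst hz
    exact ⟨u.2, hxD⟩
  | @cons u v w hadj p ih =>
    -- the edge `u ∼ v` of the mesh graph of `N` is an edge of the mesh graph of `D`
    have hadjN : (meshGraph N.carrier δ).Adj (u : Site 2) (v : Site 2) := hadj
    have hadjD : (meshGraph D.carrier δ).Adj (u : Site 2) (v : Site 2) :=
      meshGraph_adj_iff.2 ⟨(meshGraph_adj_iff.1 hadjN).1,
        (meshGraph_adj_iff.1 hadjN).2.trans (closure_mono hND)⟩
    -- membership in `Ω_δ(D)` propagates along it (`v` is a mesh vertex of `D`)
    have hvD : (v : Site 2) ∈ meshDomain D.carrier δ :=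
      Literature.Probability.Percolation.mem_meshDomain_of_meshGraph_adj hxD (hND v.2) hadjD
    obtain ⟨q, hq⟩ := ih hvD
    refine ⟨SimpleGraph.Walk.cons (discreteDomainGraph_adj_iff.2 ⟨hadjD, hxD, hvD⟩) q, ?_⟩
    intro z hz
    rw [SimpleGraph.Walk.support_cons, List.mem_cons] at hz
    rcases hz with rfl | hz
    · exact ⟨u.2, hxD⟩
    · exact hq z hz

end Summit.CriticalPhenomena.SAWScalingLimit.Theorems.AvoidanceLimit.Anchor

end
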